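import Mathlib.Tactic.Module
import Literature.Analysis.FluidPDE.StationaryEulerRelaxationHighDim
import HarnessLib

/-!
# Explicit laminates in `int 𝒦_r^{co}` for `d ≥ 3` and the relaxed family of §4
(Choffrut–Székelyhidi 2014, §4)

Topic `Literature/Analysis/FluidPDE`. Support file of the proof of
`Literature.Analysis.FluidPDE.Torus.ChoffrutSzekelyhidi2014_thm1` (Choffrut–Székelyhidi, SIAM
J. Math. Anal. 46 (2014) = arXiv:1401.4301, Thm. 1). For `d ≥ 3` the paper obtains the
perturbation property (P) for `𝒰_r = int 𝒦_r^{co}` from single admissible segments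
(Lemma 10 = De Lellis–Székelyhidi 2010, Lemma 6, whose proof rests on Carathéodory's theorem
applied to `𝒦_r^{co} = conv 𝒦_r`) and Lemma 11 (admissible segments are `Λ`-directions when
`d ≥ 3`).

**Deviation (a formally shorter road to the same interface).** We produce instead, for every
`w = (v, u) ∈ 𝒰_r` and `r' < r` close to `r`, an *explicit laminate of order `≤ d`* in
`𝓛(𝒰_r)` with barycentre `w` and atoms in `𝒦_{r'}` — i.e. exactly the laminate property of
Prop. 15 (iii) that the paper establishes in `d = 2`, so that both dimensions feed the single
interface `RelaxedFamily` (and (P) follows uniformly by Prop. 6–7 / Cor. 16):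

1. write the positive definite gap matrix `N = u - v ⊗ v + (r'/d) Id = Σᵢ μᵢ fᵢ ⊗ fᵢ` in an
   orthonormal eigenbasis (`μᵢ > 0`, `Σ μᵢ = s² := r' - |v|²`) and split `w` in the stress
   directions `(0, ū)` — wave directions with `η = fᵢ` an eigenvector of `ū` — into the states
   `Aᵢ = (v, v ⊗ v - (r'/d) Id + s² fᵢ ⊗ fᵢ)` with weights `μᵢ/s²` (`uLam`);
2. split each `Aᵢ` into the two points `(a, a ⊗ a - (r'/d) Id)`, `(b, b ⊗ b - (r'/d) Id)` of
   `𝒦_{r'}` with `a = v + α fᵢ`, `b = v - β fᵢ`, `α = ρ - p`, `β = ρ + p`, `p = v · fᵢ`,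
   `ρ = √(p² + s²)` (so that `αβ = s²`, `|a|² = |b|² = r'`), weights `β/(α+β)`, `α/(α+β)`; the
   direction `(a - b, a ⊗ a - b ⊗ b)` is a wave direction with any `η ⊥ v, fᵢ` (`q = 0`) — this is
   Lemma 11 of the paper and the only place where `d ≥ 3` is used (`vLam`).

All splitting segments lie in the convex set `𝒰_r`. As a by-product `𝒦_r^{co} ⊆ conv 𝒦_r`
(the non-trivial inclusion of De Lellis–Székelyhidi 2010, Lemma 3) in `d ≥ 3`.
The output is `HighDim.relaxedFamily : RelaxedFamily d` (Cor. 12 of the paper in laminate form).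

## References

* A. Choffrut, L. Székelyhidi Jr., *Weak solutions to the stationary incompressible Euler
  equations*, SIAM J. Math. Anal. 46 (2014), §4: Lemma 10, Lemma 11, Cor. 12; §5 Prop. 15 (iii).
* C. De Lellis, L. Székelyhidi Jr., Arch. Ration. Mech. Anal. 195 (2010), Lemma 3, Lemma 6.
-/

noncomputable section

open scoped InnerProductSpace Matrix

namespace Literature.Analysis.FluidPDE

namespace StationaryEuler

namespace HighDim

variable {d : Type*} [Fintype d] [DecidableEq d]

/-! ## The data of the construction -/

variable (d) in
/-- Data of the explicit laminate at a point `(v, u)` with `u - v ⊗ v + (r'/d) Id = Σᵢ μᵢ fᵢ ⊗ fᵢ`: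
the velocity `v`, the level `r'`, an orthonormal basis `f`, positive weights `μ` with
`|v|² + Σ μᵢ = r'`, and for each `i` a non-zero vector `ηᵢ ⊥ v, fᵢ` (Lemma 11).
[cite: ChoffrutSzekelyhidi2014, §4] -/
structure SplitData where
  /-- the velocity of the barycentre -/
  v : EuclideanSpace ℝ d
  /-- the level of the target constraint set `𝒦_{r'}` -/
  r' : ℝ
  /-- an orthonormal (eigen)basis -/
  f : OrthonormalBasis d ℝ (EuclideanSpace ℝ d)
  /-- the (eigen)weights -/
  μ : d → ℝ
  /-- the wave-cone certificates of the velocity splits -/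
  ηs : d → EuclideanSpace ℝ d
  μ_pos : ∀ i, 0 < μ i
  norm_sq_add : ‖v‖ ^ 2 + ∑ i, μ i = r'
  ηs_ne : ∀ i, ηs i ≠ 0
  inner_v_ηs : ∀ i, ⟪v, ηs i⟫_ℝ = 0
  inner_f_ηs : ∀ i, ⟪f i, ηs i⟫_ℝ = 0

namespace SplitData

variable (D : SplitData d)

/-- `s² = Σᵢ μᵢ = r' - |v|²`. [folklore] -/
def s2 : ℝ := ∑ i, D.μ i

omit [DecidableEq d] in
/-- `s² > 0`. [folklore] -/
theorem s2_pos [Nonempty d] : 0 < D.s2 :=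
  Finset.sum_pos (fun i _ => D.μ_pos i) Finset.univ_nonempty

omit [DecidableEq d] in
/-- `s² = r' - |v|²`. [folklore] -/
theorem s2_eq : D.s2 = D.r' - ‖D.v‖ ^ 2 := by
  have := D.norm_sq_add; unfold s2; linarith

/-- The stress `v ⊗ v - (r'/d) Id` of the "centre" of `𝒦_{r'}` above `v`. [folklore] -/
def base : Matrix d d ℝ := tensorSelf D.v - (D.r' / Fintype.card d) • (1 : Matrix d d ℝ)

/-- The rank-one projector `fᵢ ⊗ fᵢ`. [folklore] -/
def proj (i : d) : Matrix d d ℝ := Matrix.vecMulVec (⇑(D.f i)) (⇑(D.f i))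

/-- The gap matrix of `(v, base + X)` at level `r'` is `X`. [folklore] -/
theorem gap_mkSt_base_add (X : Matrix d d ℝ) : gap D.r' (mkSt D.v (D.base + X)) = X := by
  rw [gap, str_mkSt, vel_mkSt, base]; abel

/-- `fᵢ · fⱼ = δᵢⱼ`. [folklore] -/
theorem f_dot (i j : d) : (⇑(D.f i)) ⬝ᵥ (⇑(D.f j)) = if i = j then 1 else 0 := by
  rw [← inner_eq_dotProduct]; exact orthonormal_iff_ite.1 D.f.orthonormal i j

/-- `(fₖ ⊗ fₖ) fᵢ = δₖᵢ fᵢ`. [folklore] -/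
theorem proj_mulVec_f (k i : d) : D.proj k *ᵥ ⇑(D.f i) = if k = i then ⇑(D.f i) else 0 := by
  rw [proj, vecMulVec_mulVec_eq_smul, f_dot]
  by_cases h : k = i
  · subst h; simp
  · simp [h]

omit [DecidableEq d] in
/-- `tr (fᵢ ⊗ fᵢ) = 1`. [folklore] -/
theorem trace_proj [DecidableEq d] (i : d) : (D.proj i).trace = 1 := by
  rw [proj, Matrix.trace_vecMulVec, f_dot, if_pos rfl]

omit [DecidableEq d] in
/-- `fᵢ ⊗ fᵢ` is symmetric. [folklore] -/
theorem proj_isSymm (i : d) : (D.proj i).IsSymm := tensorSelf_isSymm _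

omit [DecidableEq d] in
/-- `xᵀ (fᵢ ⊗ fᵢ) x ≥ 0`. [folklore] -/
theorem proj_form_nonneg (i : d) (x : d → ℝ) : 0 ≤ x ⬝ᵥ (D.proj i *ᵥ x) := by
  rw [proj, dotProduct_vecMulVec_mulVec]; exact sq_nonneg _

/-- `base` is symmetric. [folklore] -/
theorem base_isSymm : D.base.IsSymm := (tensorSelf_isSymm _).sub (Matrix.isSymm_one.smul _)

/-- `tr base = |v|² - r'`. [folklore] -/
theorem trace_base [Nonempty d] : D.base.trace = ‖D.v‖ ^ 2 - D.r' := by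
  have hc : (Fintype.card d : ℝ) ≠ 0 := by exact_mod_cast Fintype.card_ne_zero
  rw [base, Matrix.trace_sub, trace_tensorSelf, Matrix.trace_smul, Matrix.trace_one, smul_eq_mul,
    div_mul_cancel₀ _ hc]

/-- **States above `v` with a nonnegative stress increment of trace `s²` lie in `𝒰_r`, `r > r'`.**
[folklore] -/
theorem mkSt_base_add_mem_U [Nonempty d] {X : Matrix d d ℝ} (hXs : X.IsSymm) (hXt : X.trace = D.s2)
    (hXp : ∀ x, 0 ≤ x ⬝ᵥ (X *ᵥ x)) {r : ℝ} (hr : D.r' < r) : mkSt D.v (D.base + X) ∈ U r := by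
  refine ⟨⟨?_, ?_⟩, fun x hx => ?_⟩
  · rw [str_mkSt]; exact D.base_isSymm.add hXs
  · rw [str_mkSt, Matrix.trace_add, D.trace_base, hXt, s2_eq]; ring
  · rw [dotProduct_gap_mulVec_eq_add r D.r', gap_mkSt_base_add]
    have hpos : 0 < ∑ i, x i ^ 2 := by
      obtain ⟨i, hi⟩ := Function.ne_iff.1 hx
      have hi' : 0 < x i ^ 2 := sq_pos_iff.2 (by simpa using hi)
      exact lt_of_lt_of_le hi' (Finset.single_le_sum (fun j _ => sq_nonneg (x j))
        (Finset.mem_univ i))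
    have hc : (0 : ℝ) < Fintype.card d := by exact_mod_cast Fintype.card_pos
    have := hXp x
    have : 0 < (r - D.r') / Fintype.card d * ∑ i, x i ^ 2 := mul_pos (div_pos (by linarith) hc) hpos
    linarith

/-! ## Step 2: the velocity splits (Lemma 11) -/

/-- `p = v · fᵢ`. [folklore] -/
def pc (i : d) : ℝ := ⟪D.v, D.f i⟫_ℝ

/-- `ρ = √(p² + s²)`. [folklore] -/
def ρ (i : d) : ℝ := Real.sqrt (D.pc i ^ 2 + D.s2)

/-- `α = ρ - p ≥ 0`. [folklore] -/
def α (i : d) : ℝ := D.ρ i - D.pc i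

/-- `β = ρ + p ≥ 0`. [folklore] -/
def β (i : d) : ℝ := D.ρ i + D.pc i

variable [Nonempty d]

omit [DecidableEq d] in
/-- `ρ² = p² + s²`. [folklore] -/
theorem ρ_sq (i : d) : D.ρ i ^ 2 = D.pc i ^ 2 + D.s2 :=
  Real.sq_sqrt (by linarith [sq_nonneg (D.pc i), D.s2_pos])

omit [DecidableEq d] in
/-- `ρ > 0`. [folklore] -/
theorem ρ_pos (i : d) : 0 < D.ρ i := Real.sqrt_pos.2 (by linarith [sq_nonneg (D.pc i), D.s2_pos])

omit [DecidableEq d] in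
/-- `|p| < ρ`. [folklore] -/
theorem abs_pc_lt_ρ (i : d) : |D.pc i| < D.ρ i :=
  abs_lt.2 (abs_lt_of_sq_lt_sq' (by rw [ρ_sq]; linarith [D.s2_pos]) (D.ρ_pos i).le)

omit [DecidableEq d] in
/-- `α > 0`. [folklore] -/
theorem α_pos (i : d) : 0 < D.α i := by
  have := D.abs_pc_lt_ρ i; unfold α; linarith [le_abs_self (D.pc i)]

omit [DecidableEq d] in
/-- `β > 0`. [folklore] -/
theorem β_pos (i : d) : 0 < D.β i := by
  have := D.abs_pc_lt_ρ i; unfold β; linarith [neg_abs_le (D.pc i)]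

omit [DecidableEq d] in
/-- `αβ = s²`. [folklore] -/
theorem α_mul_β (i : d) : D.α i * D.β i = D.s2 := by
  have := D.ρ_sq i; unfold α β; nlinarith

/-- The two velocities `a = v + α fᵢ`, `b = v - β fᵢ`. [folklore] -/
def va (i : d) : EuclideanSpace ℝ d := D.v + D.α i • D.f i

/-- The two velocities `a = v + α fᵢ`, `b = v - β fᵢ`. [folklore] -/
def vb (i : d) : EuclideanSpace ℝ d := D.v - D.β i • D.f i

/-- The state of `𝒦_{r'}` above a velocity. [folklore] -/
def kState (a : EuclideanSpace ℝ d) : State d :=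
  mkSt a (tensorSelf a - (D.r' / Fintype.card d) • (1 : Matrix d d ℝ))

omit [DecidableEq d] [Nonempty d] in
/-- `‖fᵢ‖ = 1`. [folklore] -/
theorem norm_f (i : d) : ‖D.f i‖ = 1 := D.f.orthonormal.1 i

omit [DecidableEq d] in
/-- `|a|² = r'`. [folklore] -/
theorem norm_va_sq (i : d) : ‖D.va i‖ ^ 2 = D.r' := by
  have h1 : ‖D.va i‖ ^ 2 = ‖D.v‖ ^ 2 + 2 * D.α i * D.pc i + D.α i ^ 2 := by
    rw [va, norm_add_sq_real, norm_smul, D.norm_f, mul_one, inner_smul_right, Real.norm_eq_abs,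
      sq_abs, pc]; ring
  have h2 : D.α i ^ 2 + 2 * D.pc i * D.α i = D.s2 := by
    have := D.ρ_sq i; unfold α; nlinarith
  rw [h1, ← D.norm_sq_add]; unfold s2 at h2; linarith

omit [DecidableEq d] in
/-- `|b|² = r'`. [folklore] -/
theorem norm_vb_sq (i : d) : ‖D.vb i‖ ^ 2 = D.r' := by
  have h1 : ‖D.vb i‖ ^ 2 = ‖D.v‖ ^ 2 - 2 * D.β i * D.pc i + D.β i ^ 2 := by
    rw [vb, norm_sub_sq_real, norm_smul, D.norm_f, mul_one, inner_smul_right, Real.norm_eq_abs,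
      sq_abs, pc]; ring
  have h2 : D.β i ^ 2 - 2 * D.pc i * D.β i = D.s2 := by
    have := D.ρ_sq i; unfold β; nlinarith
  rw [h1, ← D.norm_sq_add]; unfold s2 at h2; linarith

omit [Nonempty d] in
/-- States above a velocity of squared length `r'` lie in `𝒦_{r'}`. [folklore] -/
theorem kState_mem_K {a : EuclideanSpace ℝ d} (ha : ‖a‖ ^ 2 = D.r') : D.kState a ∈ K D.r' := by
  refine ⟨by rw [kState, vel_mkSt]; exact ha, by rw [kState, str_mkSt, vel_mkSt]⟩

/-- **The velocity split of `Aᵢ`** (Lemma 11): `β/(α+β) δ_{(a, a⊗a - (r'/d)Id)} + α/(α+β) δ_{(b,…)}`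
with certificate `(ηᵢ, 0)`. [cite: ChoffrutSzekelyhidi2014, Lemma 11] -/
def vLam (i : d) : Laminate d :=
  Laminate.split (D.β i / (D.α i + D.β i)) (D.ηs i) 0 (Laminate.atom (D.kState (D.va i)))
    (Laminate.atom (D.kState (D.vb i)))

/-- The target states `Aᵢ = (v, base + s² fᵢ ⊗ fᵢ)` of the stress splitting. [folklore] -/
def atomU (i : d) : State d := mkSt D.v (D.base + D.s2 • D.proj i)

/-- **The velocity split has barycentre `Aᵢ`** (`t a + (1-t) b = v` and
`t a ⊗ a + (1 - t) b ⊗ b = v ⊗ v + αβ fᵢ ⊗ fᵢ`, `αβ = s²`). [folklore] -/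
theorem bary_vLam (i : d) : (D.vLam i).bary = D.atomU i := by
  have hab : D.α i + D.β i ≠ 0 := by linarith [D.α_pos i, D.β_pos i]
  have hs := D.α_mul_β i
  rw [vLam, Laminate.bary_split, Laminate.bary_atom, Laminate.bary_atom, atomU]
  refine ext_vel_str ?_ ?_
  · rw [vel_add, vel_smul, vel_smul, kState, kState, vel_mkSt, vel_mkSt, vel_mkSt, va, vb]
    ext j
    simp only [PiLp.add_apply, PiLp.smul_apply, PiLp.sub_apply, smul_eq_mul]
    field_simp
    ring
  · rw [str_add, str_smul, str_smul, kState, kState, str_mkSt, str_mkSt, str_mkSt, base]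
    ext j k
    simp only [Matrix.add_apply, Matrix.smul_apply, Matrix.sub_apply, Matrix.vecMulVec_apply,
      smul_eq_mul, proj, va, vb, PiLp.add_apply, PiLp.smul_apply, PiLp.sub_apply]
    field_simp
    rw [← hs]
    ring

/-- `Aᵢ ∈ 𝒰_r` for `r > r'`. [folklore] -/
theorem atomU_mem_U (i : d) {r : ℝ} (hr : D.r' < r) : D.atomU i ∈ U r :=
  D.mkSt_base_add_mem_U ((D.proj_isSymm i).smul _)
    (by rw [Matrix.trace_smul, D.trace_proj, smul_eq_mul, mul_one])
    (fun x => by rw [Matrix.smul_mulVec, dotProduct_smul, smul_eq_mul]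
                 exact mul_nonneg D.s2_pos.le (D.proj_form_nonneg i x)) hr

/-- **Validity of the velocity split in `𝓛(𝒰_r)`**, `r > r'`: the direction
`(b - a, b ⊗ b - a ⊗ a)` is certified by `ηᵢ ⊥ v, fᵢ` (Lemma 11), the endpoints lie in
`𝒦_{r'} ⊆ 𝒰_r` and the segment in the convex set `𝒰_r`. [cite: ChoffrutSzekelyhidi2014, Lemma 11] -/
theorem vLam_isValid (i : d) {r : ℝ} (hr : D.r' < r) (hr' : 0 ≤ D.r') :
    (D.vLam i).IsValid (U r) := by
  have hα := D.α_pos i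
  have hβ := D.β_pos i
  have hA : D.kState (D.va i) ∈ U r := K_subset_U hr' hr (D.kState_mem_K (D.norm_va_sq i))
  have hB : D.kState (D.vb i) ∈ U r := K_subset_U hr' hr (D.kState_mem_K (D.norm_vb_sq i))
  have hva : ⟪D.va i, D.ηs i⟫_ℝ = 0 := by
    rw [va, inner_add_left, inner_smul_left, D.inner_v_ηs, D.inner_f_ηs]; simp
  have hvb : ⟪D.vb i, D.ηs i⟫_ℝ = 0 := by
    rw [vb, inner_sub_left, inner_smul_left, D.inner_v_ηs, D.inner_f_ηs]; simp
  refine ⟨by positivity, div_le_one_of_le₀ (by linarith) (by linarith), D.ηs_ne i, ?_, ?_, ?_,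
    hA, hB⟩
  · rw [Laminate.bary_atom, Laminate.bary_atom, kState, kState, mkSt_sub, vel_mkSt, inner_sub_left,
      hva, hvb, sub_zero]
  · rw [Laminate.bary_atom, Laminate.bary_atom, kState, kState, mkSt_sub, str_mkSt, zero_smul, add_zero,
      sub_sub_sub_cancel_right, Matrix.sub_mulVec, vecMulVec_mulVec_eq_smul,
      vecMulVec_mulVec_eq_smul, ← inner_eq_dotProduct, ← inner_eq_dotProduct, hva, hvb, zero_smul,
      zero_smul, sub_zero]
  · rw [Laminate.bary_atom, Laminate.bary_atom]
    exact (convex_U r).segment_subset hA hB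

omit [Nonempty d] in
/-- The atoms of the velocity split lie in `𝒦_{r'}`. [folklore] -/
theorem vLam_allAtoms [Nonempty d] (i : d) : (D.vLam i).AllAtoms (· ∈ K D.r') :=
  ⟨D.kState_mem_K (D.norm_va_sq i), D.kState_mem_K (D.norm_vb_sq i)⟩

/-! ## Step 1: the stress splitting along an enumeration of the eigenbasis -/

/-- The mass `Σ_{k ∈ L} μₖ` of a list of indices. [folklore] -/
def mass (L : List d) : ℝ := ∑ k ∈ L.toFinset, D.μ k

/-- The stress increment `Σ_{k ∈ L} μₖ fₖ ⊗ fₖ` of a list of indices. [folklore] -/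
def incr (L : List d) : Matrix d d ℝ := ∑ k ∈ L.toFinset, D.μ k • D.proj k

/-- **The stress splitting** of `(v, base + (s²/mass L) incr L)` into the `Aₖ`, `k ∈ L`, by
iterated binary splits in the directions `(0, ū)` certified by `(fₖ, s²)`, each leaf replaced
by its velocity split. [cite: ChoffrutSzekelyhidi2014, §4] -/
def uLam : List d → Laminate d
  | [] => Laminate.atom (mkSt D.v D.base)
  | [i] => D.vLam i
  | i :: j :: L =>
    Laminate.split (D.μ i / D.mass (i :: j :: L)) (D.f i) D.s2 (D.vLam i) (uLam (j :: L))

omit [Nonempty d] in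
/-- Masses of non-empty lists are positive. [folklore] -/
theorem mass_pos [Nonempty d] {L : List d} (hL : L ≠ []) : 0 < D.mass L := by
  obtain ⟨i, hi⟩ := List.exists_mem_of_ne_nil L hL
  exact Finset.sum_pos' (fun k _ => (D.μ_pos k).le) ⟨i, List.mem_toFinset.2 hi, D.μ_pos i⟩

omit [Nonempty d] in
/-- Mass of a list with a new head. [folklore] -/
theorem mass_cons_of_not_mem {i : d} {L : List d} (h : i ∉ L) :
    D.mass (i :: L) = D.μ i + D.mass L := by
  rw [mass, List.toFinset_cons, Finset.sum_insert (fun h' => h (List.mem_toFinset.1 h')), mass]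

omit [Nonempty d] in
/-- Increment of a list with a new head. [folklore] -/
theorem incr_cons_of_not_mem {i : d} {L : List d} (h : i ∉ L) :
    D.incr (i :: L) = D.μ i • D.proj i + D.incr L := by
  rw [incr, List.toFinset_cons, Finset.sum_insert (fun h' => h (List.mem_toFinset.1 h')), incr]

omit [Nonempty d] in
/-- `(incr L) fᵢ = 0` for `i ∉ L`. [folklore] -/
theorem incr_mulVec_f_of_not_mem {i : d} {L : List d} (h : i ∉ L) : D.incr L *ᵥ ⇑(D.f i) = 0 := by
  rw [incr, Matrix.sum_mulVec]
  refine Finset.sum_eq_zero fun k hk => ?_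
  rw [Matrix.smul_mulVec, D.proj_mulVec_f, if_neg, smul_zero]
  rintro rfl; exact h (List.mem_toFinset.1 hk)

omit [Nonempty d] in
/-- The increment is symmetric. [folklore] -/
theorem incr_isSymm (L : List d) : (D.incr L).IsSymm := by
  unfold incr Matrix.IsSymm
  rw [Matrix.transpose_sum]
  exact Finset.sum_congr rfl fun k _ => by rw [Matrix.transpose_smul, (D.proj_isSymm k).eq]

omit [Nonempty d] in
/-- `tr (incr L) = mass L`. [folklore] -/
theorem trace_incr (L : List d) : (D.incr L).trace = D.mass L := by
  rw [incr, Matrix.trace_sum]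
  exact Finset.sum_congr rfl fun k _ => by rw [Matrix.trace_smul, D.trace_proj, smul_eq_mul, mul_one]

omit [Nonempty d] in
/-- The increment is positive semidefinite. [folklore] -/
theorem incr_form_nonneg (L : List d) (x : d → ℝ) : 0 ≤ x ⬝ᵥ (D.incr L *ᵥ x) := by
  rw [incr, Matrix.sum_mulVec, dotProduct_sum]
  exact Finset.sum_nonneg fun k _ => by
    rw [Matrix.smul_mulVec, dotProduct_smul, smul_eq_mul]
    exact mul_nonneg (D.μ_pos k).le (D.proj_form_nonneg k x)

/-- The barycentre of the stress splitting over a non-empty list. [folklore] -/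
theorem bary_uLam {L : List d} (hL : L ≠ []) (hnd : L.Nodup) :
    (D.uLam L).bary = mkSt D.v (D.base + (D.s2 / D.mass L) • D.incr L) := by
  induction L with
  | nil => exact absurd rfl hL
  | cons i L ih =>
    cases L with
    | nil =>
      rw [show D.uLam [i] = D.vLam i from rfl, bary_vLam, atomU, mass, incr, List.toFinset_cons, List.toFinset_nil,
        insert_empty_eq, Finset.sum_singleton, Finset.sum_singleton, smul_smul,
        div_mul_cancel₀ _ (D.μ_pos i).ne']
    | cons j L =>
      have hi : i ∉ j :: L := (List.nodup_cons.1 hnd).1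
      have hnd' : (j :: L).Nodup := (List.nodup_cons.1 hnd).2
      have hm' : 0 < D.mass (j :: L) := D.mass_pos (List.cons_ne_nil j L)
      have hm : D.mass (i :: j :: L) = D.μ i + D.mass (j :: L) := D.mass_cons_of_not_mem hi
      have hmpos : 0 < D.mass (i :: j :: L) := by rw [hm]; linarith [D.μ_pos i]
      rw [show D.uLam (i :: j :: L) = Laminate.split (D.μ i / D.mass (i :: j :: L)) (D.f i) D.s2
          (D.vLam i) (D.uLam (j :: L)) from rfl, Laminate.bary_split, ih (List.cons_ne_nil j L) hnd',
        bary_vLam, atomU, D.incr_cons_of_not_mem hi, hm]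
      rw [smul_mkSt, smul_mkSt, mkSt_add]
      congr 1
      · rw [← add_smul, add_sub_cancel, one_smul]
      · rw [hm] at hmpos
        have hμ := (D.μ_pos i).ne'
        match_scalars <;> field_simp <;> ring

/-- The barycentre of a stress splitting lies in `𝒰_r`, `r > r'`. [folklore] -/
theorem bary_uLam_mem_U {L : List d} (hL : L ≠ []) (hnd : L.Nodup) {r : ℝ} (hr : D.r' < r) :
    (D.uLam L).bary ∈ U r := by
  rw [D.bary_uLam hL hnd]
  have hm := D.mass_pos hL
  refine D.mkSt_base_add_mem_U ((D.incr_isSymm L).smul _) ?_ (fun x => ?_) hr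
  · rw [Matrix.trace_smul, trace_incr, smul_eq_mul, div_mul_cancel₀ _ hm.ne']
  · rw [Matrix.smul_mulVec, dotProduct_smul, smul_eq_mul]
    exact mul_nonneg (div_pos D.s2_pos hm).le (D.incr_form_nonneg L x)

/-- **Validity of the stress splitting in `𝓛(𝒰_r)`**, `r > r'`, along a duplicate-free
non-empty list: weights `μᵢ/mass ∈ [0,1]`, certificate `(fᵢ, s²)` for the direction
`(0, (s²/mass') incr L' - s² fᵢ ⊗ fᵢ)` (which has `fᵢ` as eigenvector with eigenvalue `-s²`),
segments in the convex set `𝒰_r`. [cite: ChoffrutSzekelyhidi2014, §4] -/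
theorem uLam_isValid {L : List d} (hL : L ≠ []) (hnd : L.Nodup) {r : ℝ} (hr : D.r' < r)
    (hr' : 0 ≤ D.r') : (D.uLam L).IsValid (U r) := by
  induction L with
  | nil => exact absurd rfl hL
  | cons i L ih =>
    cases L with
    | nil => exact D.vLam_isValid i hr hr'
    | cons j L =>
      have hi : i ∉ j :: L := (List.nodup_cons.1 hnd).1
      have hnd' : (j :: L).Nodup := (List.nodup_cons.1 hnd).2
      have hm' : 0 < D.mass (j :: L) := D.mass_pos (List.cons_ne_nil j L)
      have hm : D.mass (i :: j :: L) = D.μ i + D.mass (j :: L) := D.mass_cons_of_not_mem hi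
      have hμ := D.μ_pos i
      have hf : D.f i ≠ 0 := fun h => by simpa [h] using D.norm_f i
      rw [show D.uLam (i :: j :: L) = Laminate.split (D.μ i / D.mass (i :: j :: L)) (D.f i) D.s2
          (D.vLam i) (D.uLam (j :: L)) from rfl]
      refine ⟨by rw [hm]; positivity, by rw [hm]; exact div_le_one_of_le₀ (by linarith) (by linarith),
        hf, ?_, ?_, ?_, D.vLam_isValid i hr hr', ih (List.cons_ne_nil j L) hnd'⟩
      · rw [D.bary_uLam (List.cons_ne_nil j L) hnd', bary_vLam, atomU, mkSt_sub, vel_mkSt, sub_self,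
          inner_zero_left]
      · rw [D.bary_uLam (List.cons_ne_nil j L) hnd', bary_vLam, atomU, mkSt_sub, str_mkSt,
          add_sub_add_left_eq_sub, Matrix.add_mulVec, Matrix.sub_mulVec, Matrix.smul_mulVec,
          D.incr_mulVec_f_of_not_mem hi, smul_zero, zero_sub, Matrix.smul_mulVec, D.proj_mulVec_f,
          if_pos rfl, Matrix.smul_mulVec, Matrix.one_mulVec, neg_add_cancel]
      · exact (convex_U r).segment_subset (by rw [bary_vLam]; exact D.atomU_mem_U i hr)
          (D.bary_uLam_mem_U (List.cons_ne_nil j L) hnd' hr)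

/-- All atoms of the stress splitting lie in `𝒦_{r'}`. [folklore] -/
theorem uLam_allAtoms {L : List d} (hL : L ≠ []) : (D.uLam L).AllAtoms (· ∈ K D.r') := by
  induction L with
  | nil => exact absurd rfl hL
  | cons i L ih =>
    cases L with
    | nil => exact D.vLam_allAtoms i
    | cons j L => exact ⟨D.vLam_allAtoms i, ih (List.cons_ne_nil j L)⟩

end SplitData

/-! ## Assembly: the relaxed family for `d ≥ 3` -/

/-- A non-zero vector orthogonal to `a` and `b` (`d ≥ 3`), chosen once and for all. [folklore] -/
def orthVec (hd : 3 ≤ Fintype.card d) (a b : EuclideanSpace ℝ d) : EuclideanSpace ℝ d :=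
  Classical.choose (exists_ne_zero_inner_eq_zero_of_three_le hd a b)

omit [DecidableEq d] in
/-- Defining property of `orthVec`. [folklore] -/
theorem orthVec_spec (hd : 3 ≤ Fintype.card d) (a b : EuclideanSpace ℝ d) :
    orthVec hd a b ≠ 0 ∧ ⟪a, orthVec hd a b⟫_ℝ = 0 ∧ ⟪b, orthVec hd a b⟫_ℝ = 0 :=
  Classical.choose_spec (exists_ne_zero_inner_eq_zero_of_three_le hd a b)

/-- **The laminate property of `𝒰_r = int 𝒦_r^{co}` in `d ≥ 3`** (the laminate form of Cor. 12):
every `w ∈ 𝒰_r` is, for every `ε > 0`, the barycentre of a laminate in `𝓛(𝒰_r)` with atoms in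
`𝒦_{r'}` for some `r' ∈ (r - ε, r)`, `r' > 0`. [cite: ChoffrutSzekelyhidi2014, Cor. 12] -/
theorem laminate (hd : 3 ≤ Fintype.card d) {r : ℝ} {w : State d} (hw : w ∈ U r) {ε : ℝ}
    (hε : 0 < ε) : ∃ r', r - ε < r' ∧ r' < r ∧ 0 ≤ r' ∧
      ∃ T : Laminate d, T.IsValid (U r) ∧ T.bary = w ∧ T.AllAtoms (· ∈ K r') := by
  haveI : Nonempty d := Fintype.card_pos_iff.1 (by omega)
  have hr : 0 < r := lt_of_le_of_lt (sq_nonneg _) (pos_of_mem_U hw)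
  obtain ⟨r', h1, h2, h3, hw'⟩ := exists_mem_U_of_lt hw hε hr
  have hN : (gap r' w).IsHermitian := Matrix.isHermitian_iff_isSymm.2 (gap_isSymm hw'.1.1)
  have hPD : (gap r' w).PosDef := posDef_gap hw'
  set D : SplitData d :=
    { v := vel w, r' := r', f := hN.eigenvectorBasis, μ := hN.eigenvalues,
      ηs := fun i => orthVec hd (vel w) (hN.eigenvectorBasis i),
      μ_pos := fun i => hPD.eigenvalues_pos i,
      norm_sq_add := by
        have ht := hN.trace_eq_sum_eigenvalues
        simp only [RCLike.ofReal_real_eq_id, id_eq] at ht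
        rw [← ht, trace_gap hw'.1]; ring
      ηs_ne := fun i => (orthVec_spec hd _ _).1
      inner_v_ηs := fun i => (orthVec_spec hd _ _).2.1
      inner_f_ηs := fun i => (orthVec_spec hd _ _).2.2 } with hD
  set L := (Finset.univ : Finset d).toList with hL
  have hLne : L ≠ [] := by
    rw [hL, Ne, Finset.toList_eq_nil]; exact Finset.univ_nonempty.ne_empty
  have hLnd : L.Nodup := Finset.nodup_toList _
  refine ⟨r', h1, h2, h3.le, D.uLam L, D.uLam_isValid hLne hLnd h2 h3.le, ?_, D.uLam_allAtoms hLne⟩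
  rw [D.bary_uLam hLne hLnd]
  have hmass : D.mass L = D.s2 := by
    rw [SplitData.mass, SplitData.s2, hL, Finset.toList_toFinset]
  have hincr : D.incr L = gap r' w := by
    rw [SplitData.incr, hL, Finset.toList_toFinset, eq_sum_eigenvalues_smul_vecMulVec hN]; rfl
  rw [hmass, div_self D.s2_pos.ne', one_smul, hincr]
  refine ext_vel_str (by rw [vel_mkSt]) ?_
  rw [str_mkSt, SplitData.base, gap]
  change tensorSelf (vel w) - (r' / Fintype.card d) • (1 : Matrix d d ℝ) +
    (str w - tensorSelf (vel w) + (r' / Fintype.card d) • 1) = str w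
  abel

/-- **The relaxed family in dimension `d ≥ 3`** (§4 of the paper, Cor. 12, in the laminate form
of Prop. 15 (iii)): `𝒰_r = int 𝒦_r^{co}`. [cite: ChoffrutSzekelyhidi2014, Cor. 12] -/
def relaxedFamily (hd : 3 ≤ Fintype.card d) : RelaxedFamily d where
  U := U
  subset_C := U_subset_C
  relOpen := relOpen
  K_subset := fun _ _ hr' h =>
    haveI : Nonempty d := Fintype.card_pos_iff.1 (by omega)
    K_subset_U hr' h
  laminate := fun _ _ hw ε hε => laminate hd hw hε

end HighDim

end StationaryEuler

end Literature.Analysis.FluidPDE
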